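import Literature.NumberTheory.EllipticCurves.QuadraticTwistTateFormProofs
import Literature.NumberTheory.EllipticCurves.HasseWeilAbelianConductorOggSaito
import Literature.NumberTheory.EllipticCurves.HasseWeilAbelianConductorProofs
import Literature.NumberTheory.EllipticCurves.QuadraticTwistPadicReduction
import Literature.NumberTheory.EllipticCurves.NeronComponentIndexTypeI0starProofs
import Literature.NumberTheory.DiophantineGeometry.TateAlgorithmTameTypesOddProofs
import Literature.NumberTheory.DiophantineGeometry.TateAlgorithmOggBound
import Literature.NumberTheory.DiophantineGeometry.LocalReductionFiniteBadPlacesProofs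
import Literature.NumberTheory.DiophantineGeometry.MinimalDiscriminantSpanProofs
import HarnessLib

/-!
# Kodaira types `Iₙ*` at a place `v ∤ 2`: the twist of a type-`I₀*` curve by a uniformiser has
# good reduction, `V_ℓ E` is tame, and Ogg's formula holds at the places of type `Iₙ*`
# (Silverman *ATAEC* IV.11.1, `p = 3`, columns `I₀*`, `Iₙ*`)

`Proofs` file (theorems only, no definitions, no named facts, no instances) in topic
`NumberTheory/EllipticCurves`, landed by the tenured seat of bsd.S15
(`Literature.NumberTheory.EllipticCurves.conductorNorm_eq_artinConductorNat`) as a bottom-up step in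
the printed proof of Ogg's formula at the additive places of residue characteristic `3`
(Silverman, *ATAEC*, Thm. IV.11.1, case `p = 3`, PDF pp. 366–371), column `I₀*` of the table on
p. 368: *"`Type(E/K) = I₀*`, `Type(E/M) = I₀`"* — over the ramified quadratic extension
`M = K(√π)` the curve acquires **good** reduction, so `L = K(E[ℓ])` is tamely ramified over `K`
and `δ(E/K) = δ(E/M)/2 = 0`.  In Galois form, and without leaving `K`: **the quadratic twist
`E^{(π)}` by a uniformiser `π` has good reduction at `v`**, so `I_𝔓 ∩ Γ_{K(√π)}` acts trivially
on `V_ℓ E` and the wild ramification groups (pro-`p`, `p` odd) act trivially.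

## Main results

* `WeierstrassCurve.hasGoodReductionAt_quadraticTwist_of_kodairaSymbolAt_eq_Istar_zero` — over the
  fraction field `K` of a Dedekind domain, at a place `v ∤ 2` (perfect residue field of `O_v`) of
  Kodaira type `I₀*`, and for `π ∈ K` with `ord_v(π) = 1`: `E^{(π)} = W.quadraticTwist π` has good
  reduction at `v`.  Proof: the `I₀*` normal form `N = D • M` of the integral local minimal model
  (`π ∣ a₁, a₂`, `π² ∣ a₃, a₄`, `π³ ∣ a₆`, `LocalIndex.exists_smul_of_kodairaSymbolOfMinimal_eq_Istar_zero`)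
  has `b₂ = πβ₂`, `b₄ = π²β₄`, `b₆ = π³β₆` and `ord Δ(N) = 6`
  (`addVal_Δ_toNat_eq_six_of_kodairaSymbolOfMinimal_eq_Istar_zero`, `2 ∈ O_vˣ`); the twist of
  `N_{K_v}` by `π` is `y² = x³ + π²(β₂/4)x² + π⁴(β₄/2)x + π⁶(β₆/4)`, and `(x, y) ↦ (π²x, π³y)`
  turns it into the `O_v`-integral equation `y² = x³ + (β₂/4)x² + (β₄/2)x + β₆/4` of discriminant
  `Δ(N)/π⁶ ∈ O_vˣ`; twisting commutes with base change and with changes of variables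
  (`map_quadraticTwist`, `quadraticTwist_smul`), so this is a `K_v`-model of `E^{(π)}`
  (Silverman *AEC* VII.5.1(a), VII.1.3(b));
* `WeierstrassCurve.isTameAt_rationalTate_of_kodairaSymbolAt_eq_Istar_zero`,
  `WeierstrassCurve.swanConductorAt_rationalTate_eq_zero_of_kodairaSymbolAt_eq_Istar_zero` — for
  an elliptic curve over a number field, a prime `ℓ`, a place `v ∤ 2ℓ` of type `I₀*` and `𝔓 ∣ v`:
  `V_ℓ E` is tame at `𝔓` and `Sw_𝔓(V_ℓ E) = 0` (good reduction of `E^{(π)}` gives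
  `codim (V_ℓ E^{(π)})^{I_𝔓} = 0`, `galoisRepTate_eq_one_of_forall_smul_torsion_eq`-style triviality
  via `codimFixed_inertia_rationalTate_eq_tameConductorExponent_holds`, then
  `codimFixed_inf_stabilizer_le_one_of_quadraticTwist` and
  `isTameAt_rationalTate_of_exists_fixed_of_det_eq_one_of_le`, exactly as for `v(j) < 0` in
  `QuadraticTwistTateFormProofs`);
* `WeierstrassCurve.swanConductorAt_rationalTate_eq_wildConductorExponent_of_kodairaSymbolAt_eq_Istar_zero`
  — with the discriminant side `δ_v = 0` (`wildConductorExponent_eq_zero_of_kodairaSymbolAt`,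
  `TateAlgorithmTameTypesOddProofs`): **Ogg's formula in Galois form holds at the places `v ∤ 2ℓ`
  of type `I₀*`**, in particular at those of residue characteristic `3`;
* `WeierstrassCurve.swanConductorAt_rationalTate_eq_wildConductorExponent_of_kodairaSymbolAt_eq_Istar`
  — the same at the places of type `Iₙ*`, `n ≥ 1` (there `ord_v(j) < 0`,
  `one_lt_valuation_j_of_kodairaSymbolAt_eq_Istar_succ`, and `V_ℓ E` is tame by
  `swanConductorAt_rationalTate_eq_zero_of_one_lt_valuation_j`, `QuadraticTwistTateFormProofs`),
  hence at **every place `v ∤ 2ℓ` of type `Iₙ*`, `n ≥ 0`**;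
* `WeierstrassCurve.swanConductorAt_rationalTate_eq_wildConductorExponent_of_ringChar_eq_three_of_ne_Istar`
  — the named fact `…_of_ringChar_eq_three W ℓ` (Ogg's formula at `p = 3`, Galois form) reduced to
  the additive places of residue characteristic `3` of Kodaira type `II, III, IV, IV*, III*, II*`.

## References

* [SilvermanATAEC1994] J. H. Silverman, *Advanced Topics in the Arithmetic of Elliptic Curves*,
  GTM 151: IV.9.4 Step 6 (type `I₀*`), Table 4.1; proof of Thm. IV.11.1 for `p = 3`, table p. 368
  (column `I₀*`); Thm. IV.10.2(b) and its proof (PDF pp. 358–362).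
* [SilvermanAEC2009] J. H. Silverman, *The Arithmetic of Elliptic Curves*, 2nd ed.: VII.1
  Prop. 1.3, VII.5 Prop. 5.1(a), X.5 Cor. 5.4 (quadratic twists).

## Design

Pure theorems; `noncomputable section`; §1 over a Dedekind domain (namespace `WeierstrassCurve`),
§2 over a number field.  Axioms: `propext`, `Classical.choice`, `Quot.sound`.
-/

noncomputable section

open scoped Classical NumberField
open Field IsDedekindDomain IsLocalRing

universe u

namespace WeierstrassCurve

open Literature.NumberTheory.EllipticCurves Literature.NumberTheory.GaloisRepresentations
  Literature.NumberTheory.DiophantineGeometry Literature.NumberTheory.DiophantineGeometry.TateAlgorithm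
  IsDedekindDomain.HeightOneSpectrum

/-! ## §1. The twist by a uniformiser of a curve of type `I₀*` has good reduction -/

section Dedekind

variable {A : Type*} [CommRing A] [IsDedekindDomain A] {K : Type*} [Field K] [Algebra A K]
  [IsFractionRing A K] (v : HeightOneSpectrum A) (W : WeierstrassCurve K)

/-- **A `K_v`-model of the local minimal model in `I₀*` normal form, read through its `bᵢ`.**
At a place `v ∤ 2` of Kodaira type `I₀*` (elliptic `W`, perfect residue field of `O_v`) and for
`π ∈ K` with `ord_v(π) = 1`, there is a change of variables `C` over `K_v` such that
`C • E_{K_v}` has `b₂ = πβ₂`, `b₄ = π²β₄`, `b₆ = π³β₆` with `βᵢ ∈ O_v` and `Δ = π⁶δ` with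
`δ ∈ O_vˣ` (the `I₀*` normal form `π ∣ a₁, a₂`, `π² ∣ a₃, a₄`, `π³ ∣ a₆` of Silverman *ATAEC*
IV.9.4 Step 6, `LocalIndex.exists_smul_of_kodairaSymbolOfMinimal_eq_Istar_zero`, with
`ord Δ = 6`, `addVal_Δ_toNat_eq_six_of_kodairaSymbolOfMinimal_eq_Istar_zero`).
[cite: SilvermanATAEC1994, IV.9.4 Step 6 and Table 4.1 (type I₀*)] -/
theorem exists_variableChange_b_of_kodairaSymbolAt_eq_Istar_zero [W.IsElliptic]
    [PerfectField (IsLocalRing.ResidueField (v.adicCompletionIntegers K))]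
    (h2 : ringChar (A ⧸ v.asIdeal) ≠ 2) (hT : W.kodairaSymbolAt v = .Istar 0)
    {π : K} (hπ : v.valuation K π = WithZero.exp (-1 : ℤ)) :
    ∃ (C : VariableChange (v.adicCompletion K)) (β₂ β₄ β₆ δ : v.adicCompletionIntegers K),
      IsUnit δ ∧
      (C • W.baseChange (v.adicCompletion K)).b₂ = (π : v.adicCompletion K) * β₂ ∧
      (C • W.baseChange (v.adicCompletion K)).b₄ = (π : v.adicCompletion K) ^ 2 * β₄ ∧
      (C • W.baseChange (v.adicCompletion K)).b₆ = (π : v.adicCompletion K) ^ 3 * β₆ ∧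
      (C • W.baseChange (v.adicCompletion K)).Δ = (π : v.adicCompletion K) ^ 6 * δ := by
  set O := v.adicCompletionIntegers K with hO
  have hu2 : IsUnit (2 : O) := HeightOneSpectrum.isUnit_two_adicCompletionIntegers K v h2
  -- `π` as a uniformiser `ϖ` of `O_v`
  have hπv : Valued.v (π : v.adicCompletion K) = WithZero.exp (-1 : ℤ) := by
    rw [valuedAdicCompletion_eq_valuation', hπ]
  set ϖ : O := ⟨(π : v.adicCompletion K), by
    rw [mem_adicCompletionIntegers, hπv, ← WithZero.exp_zero, WithZero.exp_le_exp]; norm_num⟩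
    with hϖdef
  have hϖ : Irreducible ϖ := irreducible_adicCompletionIntegers_of_valued_eq v ϖ hπv
  have hϖK : ((ϖ : O) : v.adicCompletion K) = (π : v.adicCompletion K) := rfl
  -- the integral local minimal model `M` and its `I₀*` normal form `N = D • M`
  set M := W.localMinimalIntegralModel v with hM
  have hΔM0 : M.Δ ≠ 0 := localMinimalIntegralModel_Δ_ne_zero v W
  rw [kodairaSymbolAt_def] at hT
  have hordM : (IsDiscreteValuationRing.addVal O M.Δ).toNat = 6 :=
    addVal_Δ_toNat_eq_six_of_kodairaSymbolOfMinimal_eq_Istar_zero hu2 M hΔM0 hT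
  obtain ⟨D, hN1, hN2, hN3, hN4, hN6, -⟩ :=
    LocalIndex.exists_smul_of_kodairaSymbolOfMinimal_eq_Istar_zero M hΔM0 hT
  set N := D • M with hN
  -- `bᵢ(N)` and `Δ(N)`
  have hN1' : N.a₁ ∈ maximalIdeal O ^ 1 := by rwa [pow_one]
  have hN2' : N.a₂ ∈ maximalIdeal O ^ 1 := by rwa [pow_one]
  have hb₂ : N.b₂ ∈ maximalIdeal O ^ 1 := OggBound.b₂_mem_pow N (n₁ := 1) (n₂ := 1) hN1' hN2'
  have hb₄ : N.b₄ ∈ maximalIdeal O ^ 2 :=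
    OggBound.b₄_mem_pow N (n₁ := 1) (n₃ := 2) (n₄ := 2) hN1' hN3 hN4
  have hb₆ : N.b₆ ∈ maximalIdeal O ^ 3 := OggBound.b₆_mem_pow N (n₃ := 2) (n₆ := 3) hN3 hN6
  obtain ⟨β₂, hβ₂⟩ := (mem_maximalIdeal_pow_iff_dvd_of_irreducible hϖ _ _).mp hb₂
  obtain ⟨β₄, hβ₄⟩ := (mem_maximalIdeal_pow_iff_dvd_of_irreducible hϖ _ _).mp hb₄
  obtain ⟨β₆, hβ₆⟩ := (mem_maximalIdeal_pow_iff_dvd_of_irreducible hϖ _ _).mp hb₆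
  obtain ⟨n, u₀, hMu⟩ := IsDiscreteValuationRing.eq_unit_mul_pow_irreducible hΔM0 hϖ
  have hn6 : n = 6 := by
    have h := IsDiscreteValuationRing.addVal_def M.Δ u₀ hϖ n hMu
    rw [h] at hordM
    simpa using hordM
  rw [hn6] at hMu
  have hΔN : N.Δ = ϖ ^ 6 * (↑D.u⁻¹ ^ 12 * ↑u₀) := by
    rw [hN, variableChange_Δ, hMu]; ring
  have hδ : IsUnit ((↑D.u⁻¹ ^ 12 * ↑u₀ : O)) := ((Units.isUnit _).pow 12).mul (Units.isUnit _)
  -- the `K_v`-model `N_{K_v} = C • E_{K_v}`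
  obtain ⟨C₀, hC₀⟩ : ∃ C₀ : VariableChange (v.adicCompletion K),
      C₀ • W.baseChange (v.adicCompletion K) = W.localMinimalModel v := ⟨_, rfl⟩
  have hMK : M.map (algebraMap O (v.adicCompletion K)) = W.localMinimalModel v := by
    rw [hM, localMinimalIntegralModel]
    exact baseChange_integralModel_eq O (W.localMinimalModel v)
  have hNK : N.map (algebraMap O (v.adicCompletion K)) =
      (D.map (algebraMap O (v.adicCompletion K)) * C₀) • W.baseChange (v.adicCompletion K) := by
    rw [mul_smul, hC₀, ← hMK, hN, map_variableChange]
  refine ⟨D.map (algebraMap O (v.adicCompletion K)) * C₀, β₂, β₄, β₆, _, hδ, ?_, ?_, ?_, ?_⟩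
  · rw [← hNK, map_b₂, hβ₂, map_mul, map_pow, pow_one]; rfl
  · rw [← hNK, map_b₄, hβ₄, map_mul, map_pow]; rfl
  · rw [← hNK, map_b₆, hβ₆, map_mul, map_pow]; rfl
  · rw [← hNK, map_Δ, hΔN, map_mul, map_pow]; rfl

/-- **At a place `v ∤ 2` of Kodaira type `I₀*` the twist by a uniformiser has good reduction**
(Galois-free form of column `I₀*` of the table in the proof of Silverman *ATAEC* Thm. IV.11.1 for
`p = 3`, PDF p. 368: `Type(E/M) = I₀` over `M = K(√π)`).  For an elliptic curve `E/K` over the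
fraction field of a Dedekind domain (characteristic `0`), a finite place `v ∤ 2` with perfect
residue field of `O_v` and `W.kodairaSymbolAt v = I₀*`, and `π ∈ K` with `ord_v(π) = 1`:
`W.quadraticTwist π` has good reduction at `v`.  With `C • E_{K_v} = N_{K_v}` as in
`exists_variableChange_b_of_kodairaSymbolAt_eq_Istar_zero` (`b₂ = πβ₂`, `b₄ = π²β₄`, `b₆ = π³β₆`,
`Δ = π⁶δ`), the twist `(E^{(π)})_{K_v} = (E_{K_v})^{(π)}` (`map_quadraticTwist`) is
`K_v`-isomorphic to `(N_{K_v})^{(π)} = y² = x³ + π²β₂/4·x² + π⁴β₄/2·x + π⁶β₆/4`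
(`quadraticTwist_smul`), which `(x, y) ↦ (π²x, π³y)` makes `O_v`-integral (`2 ∈ O_vˣ`) with
discriminant `π⁶ · π⁶δ / π¹² = δ ∈ O_vˣ`; an integral equation with unit discriminant is minimal
with good reduction (`hasGoodReduction_minimal_of_valuation_Δ_eq_one`), and good reduction passes
between `K_v`-isomorphic minimal models (`valuation_Δ_eq_of_isMinimal_of_eq_smul`; *AEC*
VII.1.3(b), VII.5.1(a)).
[cite: SilvermanATAEC1994, proof of IV.11.1, p = 3, table p. 368 (column I₀*), with IV.9.4 Step 6]
[cite: SilvermanAEC2009, VII.5 Prop. 5.1(a) and VII.1 Prop. 1.3(b)] -/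
theorem hasGoodReductionAt_quadraticTwist_of_kodairaSymbolAt_eq_Istar_zero [CharZero K]
    [W.IsElliptic] [PerfectField (IsLocalRing.ResidueField (v.adicCompletionIntegers K))]
    (h2 : ringChar (A ⧸ v.asIdeal) ≠ 2) (hT : W.kodairaSymbolAt v = .Istar 0)
    {π : K} (hπ : v.valuation K π = WithZero.exp (-1 : ℤ)) :
    (W.quadraticTwist π).HasGoodReductionAt v := by
  have hu2 : IsUnit (2 : (v.adicCompletionIntegers K)) := HeightOneSpectrum.isUnit_two_adicCompletionIntegers K v h2
  obtain ⟨C, β₂, β₄, β₆, δ, hδ, hb₂, hb₄, hb₆, hΔ⟩ :=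
    W.exists_variableChange_b_of_kodairaSymbolAt_eq_Istar_zero v h2 hT hπ
  -- valuations on `K_v`
  have hπv : Valued.v (π : (v.adicCompletion K)) = WithZero.exp (-1 : ℤ) := by
    rw [valuedAdicCompletion_eq_valuation', hπ]
  have hπ0 : (π : (v.adicCompletion K)) ≠ 0 := by
    intro h; rw [h, map_zero] at hπv; exact WithZero.exp_ne_zero hπv.symm
  have h2v : Valued.v ((2 : (v.adicCompletionIntegers K)) : (v.adicCompletion K)) = 1 := adicCompletionIntegers.isUnit_iff_valued_eq_one.mp hu2
  have h2v' : Valued.v (2 : (v.adicCompletion K)) = 1 := by exact_mod_cast h2v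
  have h4v : Valued.v (4 : (v.adicCompletion K)) = 1 := by
    rw [show (4 : (v.adicCompletion K)) = 2 * 2 by norm_num, map_mul, h2v', one_mul]
  have hδv : Valued.v ((δ : (v.adicCompletionIntegers K)) : (v.adicCompletion K)) = 1 := adicCompletionIntegers.isUnit_iff_valued_eq_one.mp hδ
  have hle : ∀ β : (v.adicCompletionIntegers K), Valued.v ((β : (v.adicCompletionIntegers K)) : (v.adicCompletion K)) ≤ 1 := fun β ↦ β.2
  haveI : CharZero (v.adicCompletion K) := charZero_of_injective_algebraMap (algebraMap K (v.adicCompletion K)).injective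
  have h20 : (2 : (v.adicCompletion K)) ≠ 0 := two_ne_zero
  have h40 : (4 : (v.adicCompletion K)) ≠ 0 := by norm_num
  have hπK0 : π ≠ 0 := by
    rintro rfl
    rw [map_zero] at hπ
    exact WithZero.exp_ne_zero hπ.symm
  -- the twisted, rescaled model `Y`
  set X := W.quadraticTwist π with hX
  haveI hXell : X.IsElliptic := by rw [hX]; exact W.isElliptic_quadraticTwist hπK0
  set T := (C • W.baseChange (v.adicCompletion K)).quadraticTwist (π : (v.adicCompletion K)) with hTdef
  have hTa₁ : T.a₁ = 0 := rfl
  have hTa₃ : T.a₃ = 0 := rfl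
  have hTa₂ : T.a₂ = (π : (v.adicCompletion K)) * ((π : (v.adicCompletion K)) * β₂) / 4 := by rw [hTdef, quadraticTwist_a₂, hb₂]
  have hTa₄ : T.a₄ = (π : (v.adicCompletion K)) ^ 2 * ((π : (v.adicCompletion K)) ^ 2 * β₄) / 2 := by rw [hTdef, quadraticTwist_a₄, hb₄]
  have hTa₆ : T.a₆ = (π : (v.adicCompletion K)) ^ 3 * ((π : (v.adicCompletion K)) ^ 3 * β₆) / 4 := by rw [hTdef, quadraticTwist_a₆, hb₆]
  have hTΔ : T.Δ = (π : (v.adicCompletion K)) ^ 6 * ((π : (v.adicCompletion K)) ^ 6 * δ) := by rw [hTdef, quadraticTwist_Δ, hΔ]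
  set Cπ : VariableChange (v.adicCompletion K) := ⟨Units.mk0 (π : (v.adicCompletion K)) hπ0, 0, 0, 0⟩ with hCπ
  set Y := Cπ • T with hY
  have hCπu : ((Cπ.u⁻¹ : (v.adicCompletion K)ˣ) : (v.adicCompletion K)) = (π : (v.adicCompletion K))⁻¹ := by
    rw [Units.val_inv_eq_inv_val, hCπ, Units.val_mk0]
  have hCr : Cπ.r = 0 := rfl
  have hCs : Cπ.s = 0 := rfl
  have hCt : Cπ.t = 0 := rfl
  have hYa₁ : Y.a₁ = 0 := by
    rw [hY, variableChange_a₁, hTa₁, hCs]; ring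
  have hYa₃ : Y.a₃ = 0 := by
    rw [hY, variableChange_a₃, hTa₃, hTa₁, hCr, hCt]; ring
  have hYa₂ : Y.a₂ = ((β₂ : (v.adicCompletionIntegers K)) : (v.adicCompletion K)) / 4 := by
    rw [hY, variableChange_a₂, hTa₂, hTa₁, hCr, hCs, hCπu]
    field_simp
    ring
  have hYa₄ : Y.a₄ = ((β₄ : (v.adicCompletionIntegers K)) : (v.adicCompletion K)) / 2 := by
    rw [hY, variableChange_a₄, hTa₄, hTa₁, hTa₂, hTa₃, hCr, hCs, hCt, hCπu]
    field_simp
    ring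
  have hYa₆ : Y.a₆ = ((β₆ : (v.adicCompletionIntegers K)) : (v.adicCompletion K)) / 4 := by
    rw [hY, variableChange_a₆, hTa₆, hTa₁, hTa₂, hTa₃, hTa₄, hCr, hCt, hCπu]
    field_simp
    ring
  have hYΔ : Y.Δ = ((δ : (v.adicCompletionIntegers K)) : (v.adicCompletion K)) := by
    rw [hY, variableChange_Δ, hTΔ, hCπu]
    field_simp
  -- `Y` is `O_v`-integral with unit discriminant
  have hmemO : ∀ {y : (v.adicCompletion K)}, Valued.v y ≤ 1 → y ∈ (algebraMap (v.adicCompletionIntegers K) (v.adicCompletion K)).range := fun {y} hy ↦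
    ⟨⟨y, (mem_adicCompletionIntegers _ _ _).mpr hy⟩, rfl⟩
  haveI hYint : Y.IsIntegral (v.adicCompletionIntegers K) := by
    rw [isIntegral_iff_forall_mem_range]
    refine ⟨hmemO ?_, hmemO ?_, hmemO ?_, hmemO ?_, hmemO ?_⟩
    · rw [hYa₁, map_zero]; exact zero_le_one
    · rw [hYa₂, map_div₀, h4v, div_one]; exact hle β₂
    · rw [hYa₃, map_zero]; exact zero_le_one
    · rw [hYa₄, map_div₀, h2v', div_one]; exact hle β₄
    · rw [hYa₆, map_div₀, h4v, div_one]; exact hle β₆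
  have hYΔv : (IsDiscreteValuationRing.maximalIdeal (v.adicCompletionIntegers K)).valuation (v.adicCompletion K) Y.Δ = 1 := by
    rw [(isEquiv_valuation_maximalIdeal_valued v).eq_one_iff_eq_one, hYΔ, hδv]
  have hgoodY : (Y.minimal (v.adicCompletionIntegers K)).HasGoodReduction (v.adicCompletionIntegers K) :=
    hasGoodReduction_minimal_of_valuation_Δ_eq_one (R := v.adicCompletionIntegers K) Y hYΔv
  -- `Y` is a `K_v`-model of `X = W.quadraticTwist π`
  have hTX : T = (⟨C.u, (π : (v.adicCompletion K)) * C.r, 0, 0⟩ : VariableChange (v.adicCompletion K)) • X.baseChange (v.adicCompletion K) := by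
    rw [hTdef, quadraticTwist_smul, hX]
    congr 1
    rw [baseChange, baseChange, map_quadraticTwist]
    rfl
  set C₁ : VariableChange (v.adicCompletion K) := Cπ * ⟨C.u, (π : (v.adicCompletion K)) * C.r, 0, 0⟩ with hC₁
  have hYX : Y = C₁ • X.baseChange (v.adicCompletion K) := by rw [hY, hTX, hC₁, mul_smul]
  -- good reduction passes from `Y.minimal` to `X.localMinimalModel v`
  obtain ⟨E₁, hE₁⟩ : ∃ E₁ : VariableChange (v.adicCompletion K), X.localMinimalModel v = E₁ • X.baseChange (v.adicCompletion K) :=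
    ⟨_, rfl⟩
  obtain ⟨E₂, hE₂⟩ : ∃ E₂ : VariableChange (v.adicCompletion K), Y.minimal (v.adicCompletionIntegers K) = E₂ • Y := ⟨_, rfl⟩
  have hrel : X.localMinimalModel v = (E₁ * C₁⁻¹ * E₂⁻¹) • Y.minimal (v.adicCompletionIntegers K) := by
    rw [hE₂, hYX, hE₁, mul_smul, mul_smul, inv_smul_smul, inv_smul_smul]
  have hYell : (Y.minimal (v.adicCompletionIntegers K)).Δ ≠ 0 := by
    rw [hE₂, variableChange_Δ, hYΔ]
    refine mul_ne_zero (pow_ne_zero _ (Units.ne_zero _)) fun h ↦ ?_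
    rw [h, map_zero] at hδv
    exact zero_ne_one hδv
  have hval := valuation_Δ_eq_of_isMinimal_of_eq_smul (v.adicCompletionIntegers K) hrel
  have hgood' := ((hasGoodReduction_iff (v.adicCompletionIntegers K)
    (Y.minimal (v.adicCompletionIntegers K))).mp hgoodY).2
  unfold HasGoodReductionAt
  exact (hasGoodReduction_iff (v.adicCompletionIntegers K) (X.localMinimalModel v)).mpr
    ⟨inferInstance, hval.trans hgood'⟩

end Dedekind

/-! ## §2. Over a number field: `V_ℓ E` is tame at the places `v ∤ 2ℓ` of type `I₀*` -/

section NumberField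

variable {K : Type u} [Field K] [NumberField K] (W : WeierstrassCurve K) (ℓ : ℕ) [Fact ℓ.Prime]

/-- **`V_ℓ E` is tamely ramified at a place `v ∤ 2ℓ` of Kodaira type `I₀*`** (column `I₀*` of
the table in the proof of Silverman *ATAEC* Thm. IV.11.1 for `p = 3`, PDF p. 368, in Galois form
and for every odd residue characteristic).  The twist `E^{(π)}` by a uniformiser has good
reduction at `v` (`hasGoodReductionAt_quadraticTwist_of_kodairaSymbolAt_eq_Istar_zero`), so `I_𝔓`
acts trivially on `V_ℓ E^{(π)}` (*AEC* VII.4.1(b), `codimFixed_inertia_rationalTate_eq_zero_of_hasGoodReductionAt`),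
`I_𝔓 ∩ Γ_{K(√π)}` fixes a line (indeed everything) of `V_ℓ E`
(`codimFixed_inf_stabilizer_le_one_of_quadraticTwist`), `[K(√π) : K] ≤ 2` is prime to `p`, and
unipotent inertia of determinant `1` is tame
(`isTameAt_rationalTate_of_exists_fixed_of_det_eq_one_of_le`) — the argument of the printed
proof of Thm. IV.10.2(b) (PDF p. 362: *"`[K':K]` is not divisible by `p` … at worst tamely
ramified"*) with `K' = K(√π)`.
[cite: SilvermanATAEC1994, proof of IV.11.1, p = 3, table p. 368 (column I₀*), and proof of Thm. IV.10.2(b) (PDF pp. 359–362)] -/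
theorem isTameAt_rationalTate_of_kodairaSymbolAt_eq_Istar_zero [W.IsElliptic]
    (h : Continuous fun x : absoluteGaloisGroup K × RationalTateModule (geomPoints W) ℓ ↦
      rationalTateRepresentation (absoluteGaloisGroup K) (geomPoints W) ℓ x.1 x.2)
    {v : HeightOneSpectrum (𝓞 K)} (hℓ : (ℓ : 𝓞 K) ∉ v.asIdeal)
    (h2 : ringChar (𝓞 K ⧸ v.asIdeal) ≠ 2) (hT : W.kodairaSymbolAt v = .Istar 0)
    {𝔓 : Ideal (absIntegers (𝓞 K) K)} (h𝔓 : 𝔓 ∈ v.primesAbove) :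
    (rationalTateGaloisRepOf (geomPoints W) ℓ h).IsTameAt (𝓞 K) 𝔓 := by
  haveI : PerfectField (ResidueField (v.adicCompletionIntegers K)) := PerfectField.ofFinite
  obtain ⟨π, hπ⟩ := v.valuation_exists_uniformizer K
  have hgood := W.hasGoodReductionAt_quadraticTwist_of_kodairaSymbolAt_eq_Istar_zero v h2 hT hπ
  have hπ0 : π ≠ 0 := by
    rintro rfl
    rw [map_zero] at hπ
    exact WithZero.exp_ne_zero hπ.symm
  haveI : (W.quadraticTwist π).IsElliptic := W.isElliptic_quadraticTwist hπ0
  haveI := stabilizer_geomSqrt_normal π (K := K)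
  have hℓK : (ℓ : K) ≠ 0 := by exact_mod_cast (Fact.out : ℓ.Prime).ne_zero
  have hp : (ringChar (𝓞 K ⧸ v.asIdeal)).Prime := by
    haveI : Finite (𝓞 K ⧸ v.asIdeal) := Ideal.finiteQuotientOfFreeOfNeBot v.asIdeal v.ne_bot
    exact CharP.char_is_prime (𝓞 K ⧸ v.asIdeal) _
  have h' := (W.quadraticTwist π).continuous_rationalGaloisRepTate_holds ℓ
  set N := MulAction.stabilizer (absoluteGaloisGroup K) (geomSqrt π) with hN
  have hcodim : (rationalTateGaloisRepOf (geomPoints W) ℓ h).codimFixed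
      (𝔓.inertia (absoluteGaloisGroup K) ⊓ N) ≤ 1 :=
    W.codimFixed_inf_stabilizer_le_one_of_quadraticTwist ℓ hℓK h hπ0 h'
      (𝔓.inertia (absoluteGaloisGroup K))
      (by rw [(W.quadraticTwist π).codimFixed_inertia_rationalTate_eq_zero_of_hasGoodReductionAt
        ℓ h' hgood hℓ h𝔓]; exact zero_le_one)
  exact W.isTameAt_rationalTate_of_exists_fixed_of_det_eq_one_of_le ℓ h hℓ h𝔓
    (𝔓.inertia (absoluteGaloisGroup K) ⊓ N)
    (fun _ hu ↦ absUpperRamificationSubgroup_le_inertia_inf_of_not_dvd_index h𝔓 N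
      (isOpen_stabilizer_geomSqrt π) (not_dvd_index_stabilizer_geomSqrt π hp h2) hu)
    (W.exists_ne_zero_fixed_of_codimFixed_le_one ℓ h _ hcodim)
    (fun _ hσ ↦ W.det_rationalTateRepresentation_eq_one_of_mem_inertia' ℓ hℓ h𝔓
      (Subgroup.mem_inf.mp hσ).1)

/-- **`Sw_𝔓(V_ℓ E) = 0` at a place `v ∤ 2ℓ` of Kodaira type `I₀*`**
(`isTameAt_rationalTate_of_kodairaSymbolAt_eq_Istar_zero`, `IsTameAt.swanConductorAt_eq_zero`):
"`δ(E/K) = δ(E/M)/2 = 0`" for `Type(E/K) = I₀*`, Silverman *ATAEC* p. 368.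
[cite: SilvermanATAEC1994, proof of IV.11.1, p = 3, table p. 368 (column I₀*)] -/
theorem swanConductorAt_rationalTate_eq_zero_of_kodairaSymbolAt_eq_Istar_zero [W.IsElliptic]
    (h : Continuous fun x : absoluteGaloisGroup K × RationalTateModule (geomPoints W) ℓ ↦
      rationalTateRepresentation (absoluteGaloisGroup K) (geomPoints W) ℓ x.1 x.2)
    {v : HeightOneSpectrum (𝓞 K)} (hℓ : (ℓ : 𝓞 K) ∉ v.asIdeal)
    (h2 : ringChar (𝓞 K ⧸ v.asIdeal) ≠ 2) (hT : W.kodairaSymbolAt v = .Istar 0)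
    {𝔓 : Ideal (absIntegers (𝓞 K) K)} (h𝔓 : 𝔓 ∈ v.primesAbove) :
    (rationalTateGaloisRepOf (geomPoints W) ℓ h).swanConductorAt (𝓞 K) 𝔓 = 0 :=
  (W.isTameAt_rationalTate_of_kodairaSymbolAt_eq_Istar_zero ℓ h hℓ h2 hT h𝔓).swanConductorAt_eq_zero

/-- **Ogg's formula in Galois form at the places `v ∤ 2ℓ` of Kodaira type `I₀*`**: both sides
vanish — `Sw_𝔓(V_ℓ E) = 0` (`swanConductorAt_rationalTate_eq_zero_of_kodairaSymbolAt_eq_Istar_zero`)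
and `δ_v = f_v - ε_v = (6 + 1 - 5) - 2 = 0` (`wildConductorExponent_eq_zero_of_kodairaSymbolAt`,
`TateAlgorithmTameTypesOddProofs`).  At a place of residue characteristic `3` this is the
conclusion of the named fact
`swanConductorAt_rationalTate_eq_wildConductorExponent_of_ringChar_eq_three W ℓ` at the places of
type `I₀*` (Silverman *ATAEC* IV.11.1, `p = 3`, column `I₀*` of the table on p. 368).
[cite: SilvermanATAEC1994, Thm. IV.11.1 and its proof for p = 3, table p. 368 (column I₀*)] -/
theorem swanConductorAt_rationalTate_eq_wildConductorExponent_of_kodairaSymbolAt_eq_Istar_zero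
    [W.IsElliptic]
    (h : Continuous fun x : absoluteGaloisGroup K × RationalTateModule (geomPoints W) ℓ ↦
      rationalTateRepresentation (absoluteGaloisGroup K) (geomPoints W) ℓ x.1 x.2)
    {v : HeightOneSpectrum (𝓞 K)} (hℓ : (ℓ : 𝓞 K) ∉ v.asIdeal)
    (h2 : ringChar (𝓞 K ⧸ v.asIdeal) ≠ 2) (hT : W.kodairaSymbolAt v = .Istar 0)
    {𝔓 : Ideal (absIntegers (𝓞 K) K)} (h𝔓 : 𝔓 ∈ v.primesAbove) :
    (rationalTateGaloisRepOf (geomPoints W) ℓ h).swanConductorAt (𝓞 K) 𝔓 =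
      (W.wildConductorExponent v : ℝ) := by
  haveI : PerfectField (ResidueField (v.adicCompletionIntegers K)) := PerfectField.ofFinite
  rw [W.swanConductorAt_rationalTate_eq_zero_of_kodairaSymbolAt_eq_Istar_zero ℓ h hℓ h2 hT h𝔓,
    W.wildConductorExponent_eq_zero_of_kodairaSymbolAt v h2 (Or.inr (Or.inr ⟨0, hT⟩)),
    Nat.cast_zero]

/-- **`Sw_𝔓(V_ℓ E) = 0` at a place `v ∤ 2ℓ` of Kodaira type `Iₙ*`, `n ≥ 1`**: such a place has
`ord_v(j) < 0` (`one_lt_valuation_j_of_kodairaSymbolAt_eq_Istar_succ`, `TateAlgorithmTameTypesOddProofs`: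
`ord c₄ = 2`, `ord Δ = n + 6` on the normal form), and at the potentially multiplicative places of
odd residue characteristic `V_ℓ E` is tame (`swanConductorAt_rationalTate_eq_zero_of_one_lt_valuation_j`,
`QuadraticTwistTateFormProofs`).  Column `Iₙ*` of the table in the proof of Silverman *ATAEC*
Thm. IV.11.1 for `p = 3` (PDF p. 368: `Type(E/M) = I₂ₙ`, `δ(E/K) = δ(E/M)/2 = 0`).
[cite: SilvermanATAEC1994, proof of IV.11.1, p = 3, table p. 368 (column Iₙ*)] -/
theorem swanConductorAt_rationalTate_eq_zero_of_kodairaSymbolAt_eq_Istar_succ [W.IsElliptic]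
    (h : Continuous fun x : absoluteGaloisGroup K × RationalTateModule (geomPoints W) ℓ ↦
      rationalTateRepresentation (absoluteGaloisGroup K) (geomPoints W) ℓ x.1 x.2)
    {v : HeightOneSpectrum (𝓞 K)} (hℓ : (ℓ : 𝓞 K) ∉ v.asIdeal)
    (h2 : ringChar (𝓞 K ⧸ v.asIdeal) ≠ 2) {n : ℕ} (hT : W.kodairaSymbolAt v = .Istar (n + 1))
    {𝔓 : Ideal (absIntegers (𝓞 K) K)} (h𝔓 : 𝔓 ∈ v.primesAbove) :
    (rationalTateGaloisRepOf (geomPoints W) ℓ h).swanConductorAt (𝓞 K) 𝔓 = 0 := by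
  haveI : PerfectField (ResidueField (v.adicCompletionIntegers K)) := PerfectField.ofFinite
  exact W.swanConductorAt_rationalTate_eq_zero_of_one_lt_valuation_j ℓ h hℓ h2
    (W.one_lt_valuation_j_of_kodairaSymbolAt_eq_Istar_succ v h2 hT) h𝔓

/-- **Ogg's formula in Galois form at the places `v ∤ 2ℓ` of Kodaira type `Iₙ*`, every
`n ≥ 0`**: `Sw_𝔓(V_ℓ E) = δ_v` (both vanish: `I₀*` by
`swanConductorAt_rationalTate_eq_zero_of_kodairaSymbolAt_eq_Istar_zero`, `Iₙ*` with `n ≥ 1` by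
`swanConductorAt_rationalTate_eq_zero_of_kodairaSymbolAt_eq_Istar_succ`, and `δ_v = 0` by
`wildConductorExponent_eq_zero_of_kodairaSymbolAt`).  At residue characteristic `3` this is the
conclusion of `swanConductorAt_rationalTate_eq_wildConductorExponent_of_ringChar_eq_three W ℓ` at
all places of type `Iₙ*` — the columns `I₀*` and `Iₙ*` of Silverman's table (*ATAEC* p. 368).
[cite: SilvermanATAEC1994, Thm. IV.11.1 and its proof for p = 3, table p. 368 (columns I₀*, Iₙ*)] -/
theorem swanConductorAt_rationalTate_eq_wildConductorExponent_of_kodairaSymbolAt_eq_Istar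
    [W.IsElliptic]
    (h : Continuous fun x : absoluteGaloisGroup K × RationalTateModule (geomPoints W) ℓ ↦
      rationalTateRepresentation (absoluteGaloisGroup K) (geomPoints W) ℓ x.1 x.2)
    {v : HeightOneSpectrum (𝓞 K)} (hℓ : (ℓ : 𝓞 K) ∉ v.asIdeal)
    (h2 : ringChar (𝓞 K ⧸ v.asIdeal) ≠ 2) {n : ℕ} (hT : W.kodairaSymbolAt v = .Istar n)
    {𝔓 : Ideal (absIntegers (𝓞 K) K)} (h𝔓 : 𝔓 ∈ v.primesAbove) :
    (rationalTateGaloisRepOf (geomPoints W) ℓ h).swanConductorAt (𝓞 K) 𝔓 =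
      (W.wildConductorExponent v : ℝ) := by
  haveI : PerfectField (ResidueField (v.adicCompletionIntegers K)) := PerfectField.ofFinite
  rw [W.wildConductorExponent_eq_zero_of_kodairaSymbolAt v h2 (Or.inr (Or.inr ⟨n, hT⟩)),
    Nat.cast_zero]
  cases n with
  | zero =>
    exact W.swanConductorAt_rationalTate_eq_zero_of_kodairaSymbolAt_eq_Istar_zero ℓ h hℓ h2 hT h𝔓
  | succ n =>
    exact W.swanConductorAt_rationalTate_eq_zero_of_kodairaSymbolAt_eq_Istar_succ ℓ h hℓ h2 hT h𝔓

/-! ## §3. Ogg's `p = 3` theorem reduced to the Kodaira types other than `Iₙ*` -/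

/-- **Ogg's formula at `p = 3` (the named fact
`swanConductorAt_rationalTate_eq_wildConductorExponent_of_ringChar_eq_three W ℓ`) follows from its
restriction to the additive places of residue characteristic `3` whose Kodaira type is not
`Iₙ*`** (`n ≥ 0`), i.e. is one of `II, III, IV, IV*, III*, II*`: the types `Iₙ*` are the theorem
`swanConductorAt_rationalTate_eq_wildConductorExponent_of_kodairaSymbolAt_eq_Istar` (`3 ≠ 2`).
This isolates what remains of Silverman's case analysis (*ATAEC* pp. 366–371) after the columns
`I₀*`, `Iₙ*` of the table on p. 368.
[cite: SilvermanATAEC1994, Thm. IV.11.1 and its proof for p = 3 (PDF pp. 366–371)] -/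
theorem swanConductorAt_rationalTate_eq_wildConductorExponent_of_ringChar_eq_three_of_ne_Istar
    (hrest : ∀ [W.IsElliptic]
      (h : Continuous fun x : absoluteGaloisGroup K × RationalTateModule (geomPoints W) ℓ ↦
        rationalTateRepresentation (absoluteGaloisGroup K) (geomPoints W) ℓ x.1 x.2)
      (v : HeightOneSpectrum (𝓞 K)) (_hℓ : (ℓ : 𝓞 K) ∉ v.asIdeal)
      (_hv : W.HasAdditiveReductionAt v) (_h3 : ringChar (𝓞 K ⧸ v.asIdeal) = 3)
      (_hT : ∀ n : ℕ, W.kodairaSymbolAt v ≠ .Istar n)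
      {𝔓 : Ideal (absIntegers (𝓞 K) K)} (_h𝔓 : 𝔓 ∈ v.primesAbove),
      (rationalTateGaloisRepOf (geomPoints W) ℓ h).swanConductorAt (𝓞 K) 𝔓 =
        (W.wildConductorExponent v : ℝ)) :
    W.swanConductorAt_rationalTate_eq_wildConductorExponent_of_ringChar_eq_three ℓ := by
  intro _ h v hℓ hv h3 𝔓 h𝔓
  have h2 : ringChar (𝓞 K ⧸ v.asIdeal) ≠ 2 := by rw [h3]; decide
  by_cases hI : ∃ n : ℕ, W.kodairaSymbolAt v = .Istar n
  · obtain ⟨n, hn⟩ := hI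
    exact W.swanConductorAt_rationalTate_eq_wildConductorExponent_of_kodairaSymbolAt_eq_Istar ℓ h hℓ
      h2 hn h𝔓
  · push Not at hI
    exact hrest h v hℓ hv h3 hI h𝔓

end NumberField

end WeierstrassCurve

end
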